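import Literature.MathematicalPhysics.KineticTheory.Hilbert6Wave0
import Literature.Analysis.FunctionSpaces.FlatTorus
import HarnessLib

-- provenance: harness21/H21/H21/Prelude/FluidKinetic/HardSpherePhaseSpace.lean @ d20076f (interim HEAD d8f2665); M5 mechanical rewrite
/-!
# The hard-sphere phase space (trunk: FluidKinetic / T-KINETIC, item K1;
notions `hard_sphere_phase_space`, `elastic_collision_law`)

`N` identical hard spheres of diameter `ε` move in a position space `X` (the flat torus
`T^d = UnitAddTorus d` or the whole space `ℝ^d = EuclideanSpace ℝ d`) with velocities in
`ℝ^d`. This file provides the *static* part of the model (Cercignani–Illner–Pulvirenti 1994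
§4.2; Gallagher–Saint-Raymond–Texier 2013 §1.1, (1.1.1)–(1.1.3), and Ch. 4 intro):

* `Kinetic.Geometry d X`: the two operations a kinetic statement needs from the position space —
  translation `x ↦ x + v` by a vector `v : ℝ^d` and the (minimal-image) separation vector
  `x - y ∈ ℝ^d` — with the two instances `Torus.geometry d` and `Euclidean.geometry d`;
* `Kinetic.Config N d X = Fin N → X × ℝ^d`, the hard-sphere domain
  `D_ε^N = {z | ∀ i ≠ j, ε ≤ |x_i - x_j|}` (closed, contact configurations included), the contact
  sets, incoming / outgoing / grazing configurations, the Liouville measure (Lebesgue measure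
  restricted to `D_ε^N`), kinetic energy and momentum;
* the two elementary moves of the dynamics: free flight `(x_i, v_i) ↦ (x_i + t v_i, v_i)` and the
  elastic reflection of the velocities of a colliding pair (GST 2013 (1.1.2)–(1.1.3)),
  `Kinetic.reflectVel`, `Kinetic.collidePair`;
* on the torus, the symmetric representative `Torus.reprSym : T^d → (-1/2, 1/2]^d` and the induced
  Euclidean (minimal-image) distance `Torus.euclidDist`.

## Mathlib / H21 reuse

The elastic collision law with a *unit* impact direction is the accepted
`Literature.MathematicalPhysics.KineticTheory.collide` (Statements/Hilbert6/Wave0) with its lemmas `collide_collide`,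
`collide_fst_add_collide_snd`, `norm_sq_collide_fst_add_norm_sq_collide_snd`; we do not redefine
it. `Kinetic.reflectVel n` is the same formula for an *unnormalised* direction `n` (the
separation vector `x_i - x_j`, of length `ε` at contact) and `reflectVel_eq_collide` identifies the
two on the unit sphere. The torus glue (`Torus.proj`, `proj_add`, `proj_zero`) is G03's
`Literature.Prelude.Sobolev.FlatTorus`; `AddCircle.equivIoc`, `AddCircle.norm_coe_eq_abs_iff`,
`MeasureSpace.pi`, `Prod.measureSpace`, `Measure.restrict` are Mathlib's. Mathlib has no hard-sphere
/ billiard phase space (grep `hard.?sphere|billiard` in Mathlib: nothing).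

## Design choices

* **Why `Geometry` is an explicit structure and not a class / an `AddAction` instance.** The
  `translate` half of a `Geometry` is exactly an additive action of `ℝ^d` on `X`, packaged as the
  reducible definition `Kinetic.Geometry.toAddAction` (usable with `letI` locally). It is not an
  instance because (i) a `Geometry` also carries the separation map `sepVec`, which is genuine extra
  data (on `T^d` it is the minimal-image vector, not determined by the action); (ii) a global
  `AddAction (EuclideanSpace ℝ d) (UnitAddTorus d)` would be a new instance on a Mathlib pi-type
  declared in H21 (CONVENTIONS: no instance hacks); (iii) the target statements fix the geometry
  explicitly (`Torus.geometry d`, `Euclidean.geometry d`), so one code path serves both `T^d` and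
  `ℝ^d` (outline T-KINETIC D2).
* The hard-sphere domain is the *closed* set `ε ≤ |x_i - x_j|` (GST 2013 (1.1.1) uses `>`; the
  boundary is Liouville-null and is where collisions happen, CIP 1994 §4.2).
* `reflectVel n` at `n = 0` is the identity (junk value from `x / 0 = 0`); it is only ever applied
  to separation vectors of norm `ε > 0`.
* `Config N d X` does not assume `[Fintype d]`; the norm and measure on `EuclideanSpace ℝ d` do.

## References

* C. Cercignani, R. Illner, M. Pulvirenti, *The Mathematical Theory of Dilute Gases* (1994), §4.2.
* I. Gallagher, L. Saint-Raymond, B. Texier, *From Newton to Boltzmann: hard spheres and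
  short-range potentials* (2013), §1.1 (1.1.1)–(1.1.3), Ch. 4 (introduction), §4.1.
-/

open MeasureTheory Metric Real Set
open scoped InnerProductSpace

namespace Literature.Analysis.FluidPDE

noncomputable section

/-! ## The elastic reflection law for an unnormalised impact direction -/

section Kinetic

variable {E : Type*} [NormedAddCommGroup E] [InnerProductSpace ℝ E]

/-- The elastic collision law for a pair of velocities `p = (v, w)` and an (unnormalised) impact
direction `n`: `v' = v - (⟪v - w, n⟫ / |n|²) n`, `w' = w + (⟪v - w, n⟫ / |n|²) n`
(GST 2013 (1.1.2)–(1.1.3) with `n = x_i - x_j`, `|n| = ε`; CIP 1994 §4.2). For a unit vector this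
is `Literature.MathematicalPhysics.KineticTheory.collide` (`reflectVel_eq_collide`). Junk value: the identity at `n = 0`. [cite: GST2013, (1.1.2] -/
def reflectVel (n : E) (p : E × E) : E × E :=
  (p.1 - (⟪p.1 - p.2, n⟫_ℝ / ‖n‖ ^ 2) • n, p.2 + (⟪p.1 - p.2, n⟫_ℝ / ‖n‖ ^ 2) • n)

/-- At `n = 0` the reflection law is the identity (documented junk value). [folklore] -/
@[simp]
theorem reflectVel_zero (p : E × E) : reflectVel (0 : E) p = p := by
  simp [reflectVel]

/-- For a unit impact direction `ω ∈ S^{d-1}` the reflection law is Wave0's `Hilbert6.collide`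
(GST 2013 (1.1.2)). [cite: GST2013, (1.1.2] -/
theorem reflectVel_eq_collide (ω : sphere (0 : E) 1) (p : E × E) :
    reflectVel (ω : E) p = Literature.MathematicalPhysics.KineticTheory.collide ω p := by
  simp [reflectVel, Literature.MathematicalPhysics.KineticTheory.collide, norm_eq_of_mem_sphere ω]

/-- The reflection law only depends on the line spanned by the impact direction:
`reflectVel (c • n) = reflectVel n` for `c ≠ 0`. [folklore] -/
theorem reflectVel_smul {c : ℝ} (hc : c ≠ 0) (n : E) (p : E × E) :
    reflectVel (c • n) p = reflectVel n p := by
  by_cases hn : n = 0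
  · simp [hn]
  have hn' : ‖n‖ ≠ 0 := norm_ne_zero_iff.2 hn
  have h : ⟪p.1 - p.2, c • n⟫_ℝ / ‖c • n‖ ^ 2 * c = ⟪p.1 - p.2, n⟫_ℝ / ‖n‖ ^ 2 := by
    rw [inner_smul_right, norm_smul, Real.norm_eq_abs, mul_pow, sq_abs]
    field_simp
  simp only [reflectVel, smul_smul, h]

/-- A nonzero impact direction, normalised, as a point of the unit sphere. [folklore] -/
def unitDir (n : E) (hn : n ≠ 0) : sphere (0 : E) 1 :=
  ⟨‖n‖⁻¹ • n, by simp [norm_smul, inv_mul_cancel₀ (norm_ne_zero_iff.2 hn)]⟩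

/-- For `n ≠ 0`, `reflectVel n` is `Hilbert6.collide` in the normalised direction `n / |n|`. [folklore] -/
theorem reflectVel_eq_collide_unitDir (n : E) (hn : n ≠ 0) (p : E × E) :
    reflectVel n p = Literature.MathematicalPhysics.KineticTheory.collide (unitDir n hn) p := by
  rw [← reflectVel_eq_collide]
  exact (reflectVel_smul (inv_ne_zero (norm_ne_zero_iff.2 hn)) n p).symm

/-- Conservation of momentum in an elastic reflection: `v' + w' = v + w` (CIP 1994 §4.2). [cite: CIP1994, §4.2] -/
theorem reflectVel_fst_add_reflectVel_snd (n : E) (p : E × E) :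
    (reflectVel n p).1 + (reflectVel n p).2 = p.1 + p.2 := by
  simp only [reflectVel]
  abel

/-- Conservation of kinetic energy in an elastic reflection: `|v'|² + |w'|² = |v|² + |w|²`
(CIP 1994 §4.2; from `Hilbert6.norm_sq_collide_fst_add_norm_sq_collide_snd`). [cite: CIP1994, §4.2] -/
theorem norm_sq_reflectVel_fst_add_norm_sq_reflectVel_snd (n : E) (p : E × E) :
    ‖(reflectVel n p).1‖ ^ 2 + ‖(reflectVel n p).2‖ ^ 2 = ‖p.1‖ ^ 2 + ‖p.2‖ ^ 2 := by
  by_cases hn : n = 0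
  · simp [hn]
  rw [reflectVel_eq_collide_unitDir n hn]
  exact Literature.MathematicalPhysics.KineticTheory.norm_sq_collide_fst_add_norm_sq_collide_snd _ p

/-- The elastic reflection with fixed impact direction is an involution
(from `Hilbert6.collide_collide`). [folklore] -/
theorem reflectVel_reflectVel (n : E) (p : E × E) : reflectVel n (reflectVel n p) = p := by
  by_cases hn : n = 0
  · simp [hn]
  rw [reflectVel_eq_collide_unitDir n hn, reflectVel_eq_collide_unitDir n hn]
  exact Literature.MathematicalPhysics.KineticTheory.collide_collide _ p

/-- The elastic reflection reverses the normal relative velocity: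
`⟪n, v' - w'⟫ = -⟪n, v - w⟫` for `n ≠ 0` (GST 2013 §1.1). [cite: GST2013, §1.1] -/
theorem inner_reflectVel_fst_sub_snd (n : E) (hn : n ≠ 0) (p : E × E) :
    ⟪n, (reflectVel n p).1 - (reflectVel n p).2⟫_ℝ = -⟪n, p.1 - p.2⟫_ℝ := by
  have hn' : ‖n‖ ^ 2 ≠ 0 := pow_ne_zero 2 (norm_ne_zero_iff.2 hn)
  have : (reflectVel n p).1 - (reflectVel n p).2 =
      (p.1 - p.2) - (2 * (⟪p.1 - p.2, n⟫_ℝ / ‖n‖ ^ 2)) • n := by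
    simp only [reflectVel, mul_smul, two_smul]
    abel
  rw [this, inner_sub_right, inner_smul_right, real_inner_self_eq_norm_sq, real_inner_comm n]
  field_simp
  ring

/-! ## Geometries: translation and separation on the position space -/

/-- The data a hard-sphere / kinetic statement needs from a position space `X` with velocity
space `ℝ^d = EuclideanSpace ℝ d`: translation of a position by a vector (`x + v`, free flight)
and the separation vector of two positions (`x - y`, resp. its minimal image on the torus), with
the action axioms `x + 0 = x`, `(x + v) + w = x + (v + w)` (GST 2013 §1.1, Ch. 4 intro: the same
theory on `T^d` and `ℝ^d`). See the module docstring for why this is an explicit structure and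
not a type class; the translation part is `Geometry.toAddAction`. [cite: GST2013, §1.1  Ch. 4 intro: the same theory on  T] -/
structure Geometry (d : Type*) [Fintype d] (X : Type*) where
  /-- Translate a position by a vector of `ℝ^d`. -/
  translate : X → EuclideanSpace ℝ d → X
  /-- The separation vector `x - y ∈ ℝ^d` of two positions (minimal image on the torus). -/
  sepVec : X → X → EuclideanSpace ℝ d
  /-- Translating by `0` does nothing. -/
  translate_zero : ∀ x, translate x 0 = x
  /-- Translations compose additively. -/
  translate_add : ∀ x v w, translate (translate x v) w = translate x (v + w)

attribute [simp] Geometry.translate_zero Geometry.translate_add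

variable {d : Type*} [Fintype d] {X : Type*}

/-- The translation part of a geometry as an additive action of `ℝ^d` on `X`
(`v +ᵥ x := G.translate x v`). A reducible definition, to be used with `letI`, deliberately not
an instance (module docstring, outline T-KINETIC D2). [folklore] -/
@[reducible]
def Geometry.toAddAction (G : Geometry d X) : AddAction (EuclideanSpace ℝ d) X where
  vadd v x := G.translate x v
  zero_vadd x := G.translate_zero x
  add_vadd v w x := by
    change G.translate x (v + w) = G.translate (G.translate x w) v
    rw [G.translate_add, add_comm]

end Kinetic

/-! ## The torus geometry -/

namespace Torus

variable {d : Type*}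

/-- The symmetric representative of a point of `T^d` in `(-1/2, 1/2]^d ⊂ ℝ^d`, coordinatewise
`AddCircle.equivIoc 1 (-1/2)`. For `x - y` this is the minimal-image separation vector of two
points of the torus (GST 2013 Ch. 4 intro: hard spheres on `T^d` with the Euclidean distance of
nearest images). [cite: GST2013, Ch. 4 intro: hard spheres on  T^d  with] -/
def reprSym (x : UnitAddTorus d) : EuclideanSpace ℝ d :=
  WithLp.toLp 2 fun i => ((AddCircle.equivIoc (1 : ℝ) (-(1 / 2 : ℝ)) (x i) : ℝ))

/-- Coordinates of the symmetric representative. [folklore] -/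
theorem reprSym_apply (x : UnitAddTorus d) (i : d) :
    reprSym x i = ((AddCircle.equivIoc (1 : ℝ) (-(1 / 2 : ℝ)) (x i) : ℝ)) := rfl

/-- The coordinates of the symmetric representative lie in `(-1/2, 1/2]`. [folklore] -/
theorem reprSym_apply_mem_Ioc (x : UnitAddTorus d) (i : d) :
    reprSym x i ∈ Ioc (-(1 / 2 : ℝ)) (1 / 2) := by
  have h := (AddCircle.equivIoc (1 : ℝ) (-(1 / 2 : ℝ)) (x i)).2
  rw [reprSym_apply]
  exact ⟨h.1, by linarith [h.2]⟩

/-- `reprSym` is a section of the covering map: `proj (reprSym x) = x`. [folklore] -/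
@[simp]
theorem proj_reprSym (x : UnitAddTorus d) : FunctionSpaces.Torus.proj (reprSym x) = x := by
  funext i
  simp only [FunctionSpaces.Torus.proj_apply, reprSym_apply]
  exact AddCircle.coe_equivIoc

/-- The coordinates of the symmetric representative realise the quotient norm of
`UnitAddCircle`: `|reprSym x i| = ‖x i‖` (`AddCircle.norm_coe_eq_abs_iff`). [folklore] -/
theorem abs_reprSym_apply (x : UnitAddTorus d) (i : d) : |reprSym x i| = ‖x i‖ := by
  have hmem := reprSym_apply_mem_Ioc x i
  have hle : |reprSym x i| ≤ |(1 : ℝ)| / 2 := by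
    rw [abs_one, abs_le]
    exact ⟨by linarith [hmem.1], hmem.2⟩
  rw [← (AddCircle.norm_coe_eq_abs_iff (1 : ℝ) one_ne_zero).2 hle, reprSym_apply, AddCircle.coe_equivIoc]

/-- `reprSym 0 = 0`. [folklore] -/
@[simp]
theorem reprSym_zero : reprSym (0 : UnitAddTorus d) = 0 := by
  ext i
  have h : |reprSym (0 : UnitAddTorus d) i| = 0 := by
    rw [abs_reprSym_apply]; simp
  simpa using h

/-- `reprSym` is measurable. [folklore] -/
theorem measurable_reprSym : Measurable (reprSym : UnitAddTorus d → EuclideanSpace ℝ d) := by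
  refine (WithLp.measurable_toLp 2 (d → ℝ)).comp (measurable_pi_lambda _ fun i => ?_)
  exact measurable_subtype_coe.comp
    ((AddCircle.measurableEquivIoc (1 : ℝ) _).measurable.comp (measurable_pi_apply i))

variable [Fintype d]

/-- The symmetric representative has norm at most `√d / 2` (each coordinate is at most `1/2` in
absolute value). [folklore] -/
def norm_reprSym_le : Prop :=
  ∀ (x : UnitAddTorus d),
    ‖reprSym x‖ ≤ Real.sqrt (Fintype.card d) / 2

/-- The Euclidean (minimal-image) distance on the flat torus:
`dist(x, y) = |reprSym (x - y)| = min_{k ∈ ℤ^d} |x̃ - ỹ + k|` (GST 2013 Ch. 4 intro). This is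
*not* Mathlib's (sup-)distance on the pi-type `UnitAddTorus d`; see `norm_sub_le_euclidDist`,
`euclidDist_le`. [cite: GST2013, Ch. 4 intro] -/
def euclidDist (x y : UnitAddTorus d) : ℝ := ‖reprSym (x - y)‖

/-- `euclidDist x y = ‖reprSym (x - y)‖`. [folklore] -/
theorem euclidDist_eq (x y : UnitAddTorus d) : euclidDist x y = ‖reprSym (x - y)‖ := rfl

/-- The minimal-image distance is symmetric. [folklore] -/
theorem euclidDist_comm (x y : UnitAddTorus d) : euclidDist x y = euclidDist y x := by
  unfold euclidDist
  rw [EuclideanSpace.norm_eq, EuclideanSpace.norm_eq]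
  congr 1
  refine Finset.sum_congr rfl fun i _ => ?_
  rw [Real.norm_eq_abs, Real.norm_eq_abs, abs_reprSym_apply, abs_reprSym_apply, Pi.sub_apply,
    Pi.sub_apply, norm_sub_rev]

/-- `euclidDist x x = 0`. [folklore] -/
@[simp]
theorem euclidDist_self (x : UnitAddTorus d) : euclidDist x x = 0 := by
  simp [euclidDist]

/-- The minimal-image distance of two projected points is at most their distance in `ℝ^d`. [folklore] -/
def euclidDist_proj_le_norm_sub : Prop :=
  ∀ (a b : EuclideanSpace ℝ d),
    euclidDist (FunctionSpaces.Torus.proj a) (FunctionSpaces.Torus.proj b) ≤ ‖a - b‖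

/-- The sup-distance of Mathlib's pi-type `UnitAddTorus d` is dominated by the minimal-image
Euclidean distance. [folklore] -/
def norm_sub_le_euclidDist : Prop :=
  ∀ (x y : UnitAddTorus d),
    ‖x - y‖ ≤ euclidDist x y

/-- The minimal-image Euclidean distance is at most `√d` times Mathlib's sup-distance on
`UnitAddTorus d`. [folklore] -/
def euclidDist_le : Prop :=
  ∀ (x y : UnitAddTorus d),
    euclidDist x y ≤ Real.sqrt (Fintype.card d) * ‖x - y‖

/-- The torus geometry: translation `x + proj v` along the covering map and minimal-image
separation vector `reprSym (x - y)` (GST 2013 Ch. 4 intro; CIP 1994 §4.2). The action axioms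
hold by additivity of `proj`. [cite: GST2013, Ch. 4 intro] -/
def geometry (d : Type*) [Fintype d] : FluidPDE.Geometry d (UnitAddTorus d) where
  translate x v := x + FunctionSpaces.Torus.proj v
  sepVec x y := reprSym (x - y)
  translate_zero x := by simp
  translate_add x v w := by rw [FunctionSpaces.Torus.proj_add, add_assoc]

/-- Unfolding lemma for the torus translation. [folklore] -/
@[simp]
theorem geometry_translate (x : UnitAddTorus d) (v : EuclideanSpace ℝ d) :
    (geometry d).translate x v = x + FunctionSpaces.Torus.proj v := rfl

/-- Unfolding lemma for the torus separation vector. [folklore] -/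
@[simp]
theorem geometry_sepVec (x y : UnitAddTorus d) : (geometry d).sepVec x y = reprSym (x - y) := rfl

/-- The norm of the torus separation vector is the minimal-image distance. [folklore] -/
theorem norm_geometry_sepVec (x y : UnitAddTorus d) :
    ‖(geometry d).sepVec x y‖ = euclidDist x y := rfl

/-- The torus separation map is (jointly) measurable. [folklore] -/
theorem measurable_geometry_sepVec :
    Measurable (fun p : UnitAddTorus d × UnitAddTorus d => (geometry d).sepVec p.1 p.2) :=
  measurable_reprSym.comp (measurable_fst.sub measurable_snd)

end Torus

/-! ## The Euclidean geometry -/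

namespace Euclidean

/-- The whole-space geometry on `ℝ^d`: translation `x + v`, separation vector `x - y`
(GST 2013 §1.1). [cite: GST2013, §1.1] -/
def geometry (d : Type*) [Fintype d] : FluidPDE.Geometry d (EuclideanSpace ℝ d) where
  translate x v := x + v
  sepVec x y := x - y
  translate_zero := add_zero
  translate_add := add_assoc

variable {d : Type*} [Fintype d]

/-- Unfolding lemma for the Euclidean translation. [folklore] -/
@[simp]
theorem geometry_translate (x v : EuclideanSpace ℝ d) : (geometry d).translate x v = x + v := rfl

/-- Unfolding lemma for the Euclidean separation vector. [folklore] -/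
@[simp]
theorem geometry_sepVec (x y : EuclideanSpace ℝ d) : (geometry d).sepVec x y = x - y := rfl

/-- The Euclidean separation map is (jointly) measurable. [folklore] -/
theorem measurable_geometry_sepVec :
    Measurable (fun p : EuclideanSpace ℝ d × EuclideanSpace ℝ d => (geometry d).sepVec p.1 p.2) :=
  measurable_fst.sub measurable_snd

end Euclidean

/-! ## Configurations, the hard-sphere domain and the Liouville measure -/

section Kinetic

/-- The `N`-particle phase space over the position space `X` with velocities in `ℝ^d`:
`z = (x_i, v_i)_{i < N}` (GST 2013 §1.1, `Z_N = (X_N, V_N)`; CIP 1994 §4.2). [cite: GST2013, §1.1   Z_N = (X_N  V_N] -/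
abbrev Config (N : ℕ) (d : Type*) (X : Type*) := Fin N → X × EuclideanSpace ℝ d

variable {N : ℕ} {d : Type*} {X : Type*}

/-- The position of particle `i` in the configuration `z`. [folklore] -/
abbrev Config.pos (z : Config N d X) (i : Fin N) : X := (z i).1

/-- The velocity of particle `i` in the configuration `z`. [folklore] -/
abbrev Config.vel (z : Config N d X) (i : Fin N) : EuclideanSpace ℝ d := (z i).2

variable [Fintype d]

/-- The hard-sphere domain `D_ε^N = {z | ∀ i ≠ j, ε ≤ |x_i - x_j|}` of `N` spheres of diameter
`ε` (GST 2013 (1.1.1), closed version; CIP 1994 §4.2 `Λ^N_{≠}`). Contact configurations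
`|x_i - x_j| = ε` are included. [cite: GST2013, (1.1.1] -/
def hardSphereDomain (G : Geometry d X) (N : ℕ) (ε : ℝ) : Set (Config N d X) :=
  {z | ∀ i j, i ≠ j → ε ≤ ‖G.sepVec (z i).1 (z j).1‖}

/-- Membership in the hard-sphere domain. [folklore] -/
theorem mem_hardSphereDomain {G : Geometry d X} {ε : ℝ} {z : Config N d X} :
    z ∈ hardSphereDomain G N ε ↔ ∀ i j, i ≠ j → ε ≤ ‖G.sepVec (z i).1 (z j).1‖ :=
  Iff.rfl

/-- The contact set of the pair `(i, j)`: configurations of the hard-sphere domain with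
`|x_i - x_j| = ε` (GST 2013 §1.1, boundary of `D_ε^N`; CIP 1994 §4.2). [cite: GST2013, §1.1  boundary of  D_ε^N] -/
def contactSet (G : Geometry d X) (N : ℕ) (ε : ℝ) (i j : Fin N) : Set (Config N d X) :=
  {z ∈ hardSphereDomain G N ε | ‖G.sepVec (z i).1 (z j).1‖ = ε}

/-- Membership in a contact set. [folklore] -/
theorem mem_contactSet {G : Geometry d X} {ε : ℝ} {i j : Fin N} {z : Config N d X} :
    z ∈ contactSet G N ε i j ↔ z ∈ hardSphereDomain G N ε ∧ ‖G.sepVec (z i).1 (z j).1‖ = ε :=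
  Iff.rfl

/-- The pair `(i, j)` is *incoming* (pre-collisional) in `z`: `⟪x_i - x_j, v_i - v_j⟫ < 0`, the
two particles approach each other (GST 2013 §1.1, (1.1.3) "incoming velocities"; CIP 1994 §4.2).
[cite: GST2013, §1.1  (1.1.3] -/
def IsIncoming (G : Geometry d X) (z : Config N d X) (i j : Fin N) : Prop :=
  ⟪G.sepVec (z i).1 (z j).1, (z i).2 - (z j).2⟫_ℝ < 0

/-- The pair `(i, j)` is *outgoing* (post-collisional) in `z`: `⟪x_i - x_j, v_i - v_j⟫ > 0`
(GST 2013 §1.1). [cite: GST2013, §1.1] -/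
def IsOutgoing (G : Geometry d X) (z : Config N d X) (i j : Fin N) : Prop :=
  0 < ⟪G.sepVec (z i).1 (z j).1, (z i).2 - (z j).2⟫_ℝ

/-- The pair `(i, j)` is *grazing* in `z`: `⟪x_i - x_j, v_i - v_j⟫ = 0` (GST 2013 §1.1; these
configurations are excluded from the good set of the flow, Ch. 4). [cite: GST2013, §1.1] -/
def IsGrazing (G : Geometry d X) (z : Config N d X) (i j : Fin N) : Prop :=
  ⟪G.sepVec (z i).1 (z j).1, (z i).2 - (z j).2⟫_ℝ = 0

omit [Fintype d] in
/-- Exactly one of incoming / grazing / outgoing holds (trichotomy). [folklore] -/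
theorem isIncoming_or_isGrazing_or_isOutgoing [Fintype d] (G : Geometry d X) (z : Config N d X)
    (i j : Fin N) : IsIncoming G z i j ∨ IsGrazing G z i j ∨ IsOutgoing G z i j :=
  lt_trichotomy _ _

/-- The Liouville measure of the hard-sphere system: Lebesgue measure `dZ_N = ∏ dx_i dv_i`
(Mathlib's `volume` on the pi/product type, from `[MeasureSpace X]`) restricted to the hard-sphere
domain `D_ε^N` (CIP 1994 §4.2; GST 2013 §1.1). Not normalised. [cite: CIP1994, §4.2] -/
def liouville [MeasureSpace X] (G : Geometry d X) (N : ℕ) (ε : ℝ) : Measure (Config N d X) :=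
  volume.restrict (hardSphereDomain G N ε)

omit [Fintype d] in
/-- Unfolding lemma for the Liouville measure. [folklore] -/
theorem liouville_eq [Fintype d] [MeasureSpace X] (G : Geometry d X) (N : ℕ) (ε : ℝ) :
    liouville G N ε = volume.restrict (hardSphereDomain G N ε) := rfl

/-- The kinetic energy `½ ∑_i |v_i|²` of a configuration (GST 2013 §1.1; CIP 1994 §4.2). [cite: GST2013, §1.1] -/
def configEnergy (z : Config N d X) : ℝ := 2⁻¹ * ∑ i, ‖(z i).2‖ ^ 2

/-- The total momentum `∑_i v_i` of a configuration (GST 2013 §1.1). [cite: GST2013, §1.1] -/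
def configMomentum (z : Config N d X) : EuclideanSpace ℝ d := ∑ i, (z i).2

/-- The hard-sphere domain is measurable as soon as the separation map is (jointly) measurable
(true for both geometries: `Torus.measurable_geometry_sepVec`,
`Euclidean.measurable_geometry_sepVec`). [folklore] -/
theorem measurableSet_hardSphereDomain [MeasurableSpace X] (G : Geometry d X)
    (hG : Measurable fun p : X × X => G.sepVec p.1 p.2) (N : ℕ) (ε : ℝ) :
    MeasurableSet (hardSphereDomain G N ε) := by
  have : hardSphereDomain G N ε =
      ⋂ i, ⋂ j, {z : Config N d X | i ≠ j → ε ≤ ‖G.sepVec (z i).1 (z j).1‖} := by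
    ext z
    simp [mem_hardSphereDomain]
  rw [this]
  refine MeasurableSet.iInter fun i => MeasurableSet.iInter fun j => ?_
  by_cases hij : i = j
  · simp [hij]
  simp only [ne_eq, hij, not_false_eq_true, forall_const]
  have hm : Measurable fun z : Config N d X => G.sepVec (z i).1 (z j).1 :=
    hG.comp ((measurable_pi_apply i).fst.prodMk (measurable_pi_apply j).fst)
  exact measurableSet_le measurable_const hm.norm

/-- Contact sets are measurable (under the same measurability of the separation map). [folklore] -/
theorem measurableSet_contactSet [MeasurableSpace X] (G : Geometry d X)
    (hG : Measurable fun p : X × X => G.sepVec p.1 p.2) (N : ℕ) (ε : ℝ) (i j : Fin N) :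
    MeasurableSet (contactSet G N ε i j) := by
  have hm : Measurable fun z : Config N d X => G.sepVec (z i).1 (z j).1 :=
    hG.comp ((measurable_pi_apply i).fst.prodMk (measurable_pi_apply j).fst)
  exact (measurableSet_hardSphereDomain G hG N ε).inter
    (measurableSet_eq_fun hm.norm measurable_const)

/-! ## Free flight -/

/-- Free flight for time `t`: every particle moves in a straight line, `(x_i, v_i) ↦
(x_i + t v_i, v_i)` (GST 2013 (1.1.1) away from collisions; CIP 1994 §4.2). [cite: GST2013, (1.1.1] -/
def freeFlight (G : Geometry d X) (t : ℝ) (z : Config N d X) : Config N d X :=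
  fun i => (G.translate (z i).1 (t • (z i).2), (z i).2)

/-- Unfolding lemma for free flight. [folklore] -/
@[simp]
theorem freeFlight_apply (G : Geometry d X) (t : ℝ) (z : Config N d X) (i : Fin N) :
    freeFlight G t z i = (G.translate (z i).1 (t • (z i).2), (z i).2) := rfl

/-- Free flight for time `0` is the identity (from `Geometry.translate_zero`). [folklore] -/
@[simp]
theorem freeFlight_zero (G : Geometry d X) (z : Config N d X) : freeFlight G 0 z = z := by
  funext i
  simp

/-- Free flight is a one-parameter group: `S_{s+t} = S_s ∘ S_t` (from `Geometry.translate_add`).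
[folklore] -/
theorem freeFlight_add (G : Geometry d X) (s t : ℝ) (z : Config N d X) :
    freeFlight G (s + t) z = freeFlight G s (freeFlight G t z) := by
  funext i
  simp [add_smul, add_comm]

/-- Free flight preserves velocities, hence the kinetic energy. [folklore] -/
@[simp]
theorem configEnergy_freeFlight (G : Geometry d X) (t : ℝ) (z : Config N d X) :
    configEnergy (freeFlight G t z) = configEnergy z := rfl

/-- Free flight preserves the total momentum. [folklore] -/
@[simp]
theorem configMomentum_freeFlight (G : Geometry d X) (t : ℝ) (z : Config N d X) :
    configMomentum (freeFlight G t z) = configMomentum z := rfl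

/-- Free flight is measurable on `ℝ^{2dN}` (Euclidean geometry). [folklore] -/
theorem measurable_freeFlight (t : ℝ) :
    Measurable (freeFlight (N := N) (Euclidean.geometry d) t) := by
  refine measurable_pi_lambda _ fun i => ?_
  refine Measurable.prodMk ?_ (measurable_pi_apply i).snd
  exact (measurable_pi_apply i).fst.add ((measurable_pi_apply i).snd.const_smul t)

/-- Free flight preserves Lebesgue measure on the whole phase space `(ℝ^d × ℝ^d)^N` (a shear in
each factor; Liouville's theorem for free transport, CIP 1994 §4.2). [cite: CIP1994, §4.2] -/
def measurePreserving_freeFlight : Prop :=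
  ∀ (t : ℝ),
    MeasurePreserving (freeFlight (N := N) (Euclidean.geometry d) t) volume volume

/-- Free flight preserves Lebesgue measure on the whole phase space `(T^d × ℝ^d)^N` (a
measure-preserving shear in each factor, translation invariance of Haar measure on `T^d`;
CIP 1994 §4.2, GST 2013 Ch. 4). [cite: CIP1994, §4.2  GST 2013 Ch. 4] -/
def measurePreserving_freeFlight_torus : Prop :=
  ∀ (t : ℝ),
    MeasurePreserving (freeFlight (N := N) (Torus.geometry d) t) volume volume

/-! ## Binary elastic collisions -/

/-- The elastic collision of the pair `(i, j)` in the configuration `z`: positions are unchanged,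
the velocities `(v_i, v_j)` are replaced by their elastic reflection in the direction of the
separation vector `x_i - x_j` (GST 2013 (1.1.2)–(1.1.3) with `ν^{i,j} = (x_i - x_j)/ε`;
CIP 1994 §4.2). Only meaningful for `i ≠ j` (for `i = j` the separation vector of the Euclidean
and torus geometries vanishes and this is the identity). [cite: GST2013, (1.1.2] -/
def collidePair (G : Geometry d X) (i j : Fin N) (z : Config N d X) : Config N d X :=
  Function.update (Function.update z i
    ((z i).1, (reflectVel (G.sepVec (z i).1 (z j).1) ((z i).2, (z j).2)).1)) j
    ((z j).1, (reflectVel (G.sepVec (z i).1 (z j).1) ((z i).2, (z j).2)).2)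

variable {G : Geometry d X} {i j : Fin N}

/-- After the collision of `(i, j)`, particle `i` has velocity `v_i'` and unchanged position. [folklore] -/
theorem collidePair_apply_left (hij : i ≠ j) (z : Config N d X) :
    collidePair G i j z i =
      ((z i).1, (reflectVel (G.sepVec (z i).1 (z j).1) ((z i).2, (z j).2)).1) := by
  simp [collidePair, Function.update_of_ne hij]

/-- After the collision of `(i, j)`, particle `j` has velocity `v_j'` and unchanged position. [folklore] -/
theorem collidePair_apply_right (z : Config N d X) :
    collidePair G i j z j =
      ((z j).1, (reflectVel (G.sepVec (z i).1 (z j).1) ((z i).2, (z j).2)).2) := by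
  simp [collidePair]

/-- Particles other than `i, j` are unaffected by the collision of `(i, j)`. [folklore] -/
theorem collidePair_apply_of_ne {k : Fin N} (hki : k ≠ i) (hkj : k ≠ j) (z : Config N d X) :
    collidePair G i j z k = z k := by
  simp [collidePair, Function.update_of_ne hki, Function.update_of_ne hkj]

/-- A collision does not move the particles. [folklore] -/
@[simp]
theorem collidePair_apply_fst (z : Config N d X) (k : Fin N) :
    (collidePair G i j z k).1 = (z k).1 := by
  by_cases hkj : k = j
  · subst hkj; rw [collidePair_apply_right]
  by_cases hki : k = i
  · subst hki; rw [collidePair_apply_left hkj]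
  rw [collidePair_apply_of_ne hki hkj]

/-- A sum over `Fin N` is unchanged if the summand changes only at `i ≠ j` with the same
two-term sum there. [folklore] -/
private theorem sum_eq_sum_of_pair {M : Type*} [AddCommMonoid M] (hij : i ≠ j) {f g : Fin N → M}
    (hfg : f i + f j = g i + g j) (h : ∀ k, k ≠ i → k ≠ j → f k = g k) :
    ∑ k, f k = ∑ k, g k := by
  have hj : j ∈ Finset.univ.erase i := Finset.mem_erase.2 ⟨hij.symm, Finset.mem_univ j⟩
  rw [← Finset.add_sum_erase _ _ (Finset.mem_univ i), ← Finset.add_sum_erase _ _ hj,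
    ← Finset.add_sum_erase _ _ (Finset.mem_univ i), ← Finset.add_sum_erase _ _ hj,
    ← add_assoc, ← add_assoc, hfg]
  congr 1
  refine Finset.sum_congr rfl fun k hk => ?_
  simp only [Finset.mem_erase] at hk
  exact h k hk.2.1 hk.1

/-- A binary elastic collision conserves the kinetic energy (GST 2013 §1.1; via
`Hilbert6.norm_sq_collide_fst_add_norm_sq_collide_snd`). [cite: GST2013, §1.1] -/
theorem configEnergy_collidePair (hij : i ≠ j) (z : Config N d X) :
    configEnergy (collidePair G i j z) = configEnergy z := by
  unfold configEnergy
  congr 1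
  refine sum_eq_sum_of_pair hij ?_ fun k hki hkj => by rw [collidePair_apply_of_ne hki hkj]
  rw [collidePair_apply_left hij, collidePair_apply_right]
  exact norm_sq_reflectVel_fst_add_norm_sq_reflectVel_snd _ _

/-- A binary elastic collision conserves the total momentum (GST 2013 §1.1; via
`Hilbert6.collide_fst_add_collide_snd`). [cite: GST2013, §1.1] -/
theorem configMomentum_collidePair (hij : i ≠ j) (z : Config N d X) :
    configMomentum (collidePair G i j z) = configMomentum z := by
  unfold configMomentum
  refine sum_eq_sum_of_pair hij ?_ fun k hki hkj => by rw [collidePair_apply_of_ne hki hkj]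
  rw [collidePair_apply_left hij, collidePair_apply_right]
  exact reflectVel_fst_add_reflectVel_snd _ _

/-- The binary elastic collision is an involution (via `Hilbert6.collide_collide`). [folklore] -/
theorem collidePair_collidePair (hij : i ≠ j) (z : Config N d X) :
    collidePair G i j (collidePair G i j z) = z := by
  have hn : G.sepVec (collidePair G i j z i).1 (collidePair G i j z j).1 =
      G.sepVec (z i).1 (z j).1 := by
    simp
  have hp : ((collidePair G i j z i).2, (collidePair G i j z j).2) =
      reflectVel (G.sepVec (z i).1 (z j).1) ((z i).2, (z j).2) := by
    rw [collidePair_apply_left hij, collidePair_apply_right]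
  funext k
  by_cases hkj : k = j
  · subst hkj
    rw [collidePair_apply_right, hn, hp, reflectVel_reflectVel, collidePair_apply_fst]
  by_cases hki : k = i
  · subst hki
    rw [collidePair_apply_left hkj, hn, hp, reflectVel_reflectVel, collidePair_apply_fst]
  rw [collidePair_apply_of_ne hki hkj, collidePair_apply_of_ne hki hkj]

/-- The collision law exchanges pre- and post-collisional configurations: `(i, j)` is outgoing
after the collision iff it was incoming before (GST 2013 §1.1, (1.1.3)). For `i ≠ j`; if the
separation vector vanishes both sides are false. [cite: GST2013, §1.1  (1.1.3] -/
theorem isOutgoing_collidePair_iff (hij : i ≠ j) (z : Config N d X) :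
    IsOutgoing G (collidePair G i j z) i j ↔ IsIncoming G z i j := by
  unfold IsOutgoing IsIncoming
  have hn : G.sepVec (collidePair G i j z i).1 (collidePair G i j z j).1 =
      G.sepVec (z i).1 (z j).1 := by
    simp
  rw [hn, collidePair_apply_left hij, collidePair_apply_right]
  by_cases h0 : G.sepVec (z i).1 (z j).1 = 0
  · simp [h0]
  rw [inner_reflectVel_fst_sub_snd _ h0, neg_pos]

/-- Symmetrically, `(i, j)` is incoming after the collision iff it was outgoing before. [folklore] -/
theorem isIncoming_collidePair_iff (hij : i ≠ j) (z : Config N d X) :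
    IsIncoming G (collidePair G i j z) i j ↔ IsOutgoing G z i j := by
  rw [← isOutgoing_collidePair_iff hij, collidePair_collidePair hij]

/-- Collisions do not move particles, so they preserve the hard-sphere domain. [folklore] -/
theorem collidePair_mem_hardSphereDomain_iff {ε : ℝ} (z : Config N d X) :
    collidePair G i j z ∈ hardSphereDomain G N ε ↔ z ∈ hardSphereDomain G N ε := by
  simp [mem_hardSphereDomain]

end Kinetic

end

end Literature.Analysis.FluidPDE
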